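import Summits.QuantumFields.BalabanUV.T4Continuum.Support.NE7SoftOperatorSlicePositivity
import Summits.QuantumFields.BalabanUV.T4Continuum.Support.NE3HessShapes
import Summits.QuantumFields.BalabanUV.T4Continuum.Support.NE3HessBounds

/-!
# NE7SoftOperatorEnergyForm — THE GÅRDING (ENERGY) FORM OF THE POSITIVITY LETTER (P_a) AND ITS REDUCTION TO ONE CONSTRAINED POINCARÉ INEQUALITY: on every skew torus 1-form `b`,
# `⟪b, S_a b⟫ ≥ curlSq_W(Fb)∕n − 28·d·η·dirSq(Fb) + ‖R D_W† b‖² + a‖Q̄_W b‖²` (`η` = plaquette radius of the background), hence (P_a) ⟸ (CP_W) «`dirSq(Fb) ≤ C₁·(curlSq_W(Fb)∕n +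
# ‖R D_W† b‖²) + C₂·‖Q̄_W b‖²`» in the regime `28dη·C₁ < 1`, `28dη·C₂ < a` — print's route [B8] (1.38)–(1.40) ⟹ [B9] Thm 3.11, on OUR carrier (file 141 of the curved (APE), F212)

Cell `pub-balaban`, rung (B)+1 sub-cell t4, lineage `b2b-balaban-t4-ne7-p1` (CRUX PROVER NE7 #1 = OWNER of row NE7), generation 85; memo
`t4/b2b-balaban-t4-ne7-p1-g85/LAGRANGE-CARRIER.md` §10–§12.
WHY.  The END of record F204 `NE7ApeCurvedRepRoadBPositivityMassEnd` rests on (P_a) «`softSymOpKa a` positive definite on the skew torus 1-forms».  Files F206–F211 prepared a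
three-component (slice ∕ pure gauge ∕ lift) assembly.  PRINT argues differently and more simply ([B8] §1 (1.38)–(1.40), [B9] Thm 3.11): the Hessian of the Wilson action at a
small-field background is a GÅRDING form — coercive curl energy minus a slack of size (plaquette radius)·‖field‖² — and the slack is absorbed by ONE constrained Poincaré inequality
bounding ‖field‖² by the curl energy, the gauge-fixing square and the averaging square.  Row NE3 already holds the Gårding inequality for OUR Hessian
(`NE3HessBounds.hess_self_ge`: `hess V X X W ≥ Σ‖curl‖²∕n − 7η·Σ bondSq`) and the bond multiplicity on the torus (`NE3HessShapes.sum_plaqsOf_bondSq_le`, constant `4d`), and proves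
the constrained Poincaré inequality on ITS slice (`classSlicePoincare_of_lines`: `M⁻²·dirSq ≤ C_P·curlSq` on `frameFreeBlockLandauW`).  THIS file puts them on the carrier of
F192∕F202: (P_a) on ALL skew forms follows from the single letter (CP_W) — the successor's one remaining target for the first hypothesis of F204 (with `C₁ = C_P·M²`, `M = L^{j+1}`,
the regime `28dη·C_P·M² < 1` is the class line «plaquette radius × M² small», cf. `hθx` of F204).
WHAT ([folklore]; 0 def, 0 sorry).  §1 **`inner_softSymOpKa_self_ge_energy`** (the Gårding form of `⟪b, S_a b⟫`).  §2 **`inner_softSymOpKa_self_ge_of_constrainedPoincare`**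
(quantitative: `μ·dirSq(Fb) ≤ ⟪b, S_a b⟫` whenever `μC₁ + 28dηC₁ ≤ 1`, `μC₂ + 28dηC₂ ≤ a`), **`softSymOpKa_posDef_of_constrainedPoincare`** ((P_a) from (CP_W) in the strict regime).
HONEST FRAMING (page 1): (CP_W) on all skew forms is NOT proved here (row NE3 has its slice case only); (P_a) NOT proved unconditionally; (KL-B) at curved `W` NOT proved; (APE) on
curved data NOT proved; NOT ONE-STEP, NOT NE7; spine 0∕9; finite T⁴ rung (B)+1 — NOT infinite volume, NOT mass gap, NOT `BetaPertH`, NOT Clay.  Continuum YM on T⁴ ⇐ BetaPertH ∧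
nine spine estimates (0/9 proved); BetaPertH ⇐ (D1) ∧ (D4) ∧ CAP+tail; G-an2-4 gates asym, D1 and NE2/3/4.
-/

set_option autoImplicit false

open scoped BigOperators InnerProductSpace Matrix Matrix.Norms.L2Operator
open Finset

namespace Summit.QuantumFields.BalabanUV.T4Continuum.NE7SoftOperatorEnergyForm

open Literature.MathematicalPhysics.QuantumFieldTheory.Balaban1983to89
open B7Prop1Explicit B7Prop2Explicit UnitaryModel
open T4AveragingDeficitWall (IsUnitaryCfg IsSkewDir SmallField curlSq dirSq)
open T4AveragingDeficitWallBoundary (periodBox IsPeriodicCfg)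
open AveragingDeficitMultiLevelPrep (LevelSmall)
open MinimalActionLevels (perWin)
open NE3HessForm (hess)
open NE3HessBounds (bondSq hess_self_ge)
open NE3HessShapes (plaqsOf curlSq_eq_sum_plaqsOf sum_plaqsOf_bondSq_le)
open NE3HilbertSchmidtTorus
open NE3EnergyHessContTwoTerm (curlSq_nonneg dirSq_nonneg)
open NE7BalabanSoftOperator
open NE7BalabanSoftOperatorMass
open NE7SoftOperatorSlicePositivity (dirSq_extF_pos)

noncomputable section

variable {d : ℕ} {n : Type*} [Fintype n] [DecidableEq n]

section Carrier

variable [Nonempty n] {L N : ℕ} [NeZero N] (hL : 1 ≤ L) (j : ℕ) [NeZero (N * L ^ (j + 1))]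
  {W : Site d → Fin d → (Matrix n n ℂ)ˣ} {x : ℝ} (hWu : IsUnitaryCfg W) (hx : 0 ≤ x) (hs : LevelSmall d L j x) (hWx : SmallField W x)

/-! ## §1 The Gårding form of `⟪b, S_a b⟫` -/

/-- **GÅRDING FORM OF THE SOFT OPERATOR**: for a unitary background `W` of plaquette radius `η ≥ 0` (`SmallField W η`), every `a` and every skew torus 1-form `b` (`P = N·L^{j+1}`,
`Y = extF b`): `curlSq W Y (periodBox P)∕n − 28·d·η·dirSq Y (periodBox P) + ⟪R D† b, R D† b⟫ + a·⟪Q̄ b, Q̄ b⟫ ≤ ⟪b, softSymOpKa a b⟫` — row NE3's `hess_self_ge` (Gårding) and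
`sum_plaqsOf_bondSq_le` (bond multiplicity `4d`) inserted in F202's `inner_softSymOpKa_self`. [folklore] -/
theorem inner_softSymOpKa_self_ge_energy {η : ℝ} (hη : 0 ≤ η) (hWη : SmallField W η) (a : ℝ) (b : skewForms d n (N * L ^ (j + 1))) :
    curlSq W (extF (N * L ^ (j + 1)) (b : Form d n (N * L ^ (j + 1)))) (periodBox (d := d) (N * L ^ (j + 1))) / (Fintype.card n : ℝ)
      - 28 * d * η * dirSq (extF (N * L ^ (j + 1)) (b : Form d n (N * L ^ (j + 1)))) (periodBox (d := d) (N * L ^ (j + 1)))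
      + ⟪landauProjK L N (j + 1) W
          ((LinearMap.adjoint (𝕜 := ℝ) (E := skewSecs d n (N * L ^ (j + 1))) (F := skewForms d n (N * L ^ (j + 1))) (gradOpK hWu (N * L ^ (j + 1)))
            : skewForms d n (N * L ^ (j + 1)) →ₗ[ℝ] skewSecs d n (N * L ^ (j + 1))) b),
         landauProjK L N (j + 1) W
          ((LinearMap.adjoint (𝕜 := ℝ) (E := skewSecs d n (N * L ^ (j + 1))) (F := skewForms d n (N * L ^ (j + 1))) (gradOpK hWu (N * L ^ (j + 1)))
            : skewForms d n (N * L ^ (j + 1)) →ₗ[ℝ] skewSecs d n (N * L ^ (j + 1))) b)⟫_ℝ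
      + a * ⟪qbarOpK (N := N) hL j hWu hx hs hWx b, qbarOpK (N := N) hL j hWu hx hs hWx b⟫_ℝ
      ≤ ⟪b, softSymOpKa (N := N) hL j hWu hx hs hWx a b⟫_ℝ := by
  rw [inner_softSymOpKa_self]
  have hP : 1 ≤ N * L ^ (j + 1) := Nat.one_le_iff_ne_zero.mpr (NeZero.ne _)
  -- Gårding on the period window
  have hG := hess_self_ge hWu b.2 hWη (plaqsOf (periodBox (d := d) (N * L ^ (j + 1))))
  rw [← curlSq_eq_sum_plaqsOf] at hG
  have hwin : hess W (extF (N * L ^ (j + 1)) (b : Form d n (N * L ^ (j + 1)))) (extF (N * L ^ (j + 1)) (b : Form d n (N * L ^ (j + 1))))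
      (plaqsOf (periodBox (d := d) (N * L ^ (j + 1))))
      = hess W (extF (N * L ^ (j + 1)) (b : Form d n (N * L ^ (j + 1)))) (extF (N * L ^ (j + 1)) (b : Form d n (N * L ^ (j + 1)))) (perWin d (N * L ^ (j + 1))) := rfl
  rw [hwin] at hG
  -- bond multiplicity on the torus
  have hbond := sum_plaqsOf_bondSq_le hP (isPeriodicDir_extF (N * L ^ (j + 1)) (b : Form d n (N * L ^ (j + 1))))
  have h7 : 7 * η * ∑ p ∈ plaqsOf (periodBox (d := d) (N * L ^ (j + 1))), bondSq (extF (N * L ^ (j + 1)) (b : Form d n (N * L ^ (j + 1)))) p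
      ≤ 7 * η * (4 * d * dirSq (extF (N * L ^ (j + 1)) (b : Form d n (N * L ^ (j + 1)))) (periodBox (d := d) (N * L ^ (j + 1)))) :=
    mul_le_mul_of_nonneg_left hbond (by positivity)
  linarith

/-! ## §2 (P_a) from one constrained Poincaré inequality -/

/-- The real-number core of §2 (quantitative form): from the Gårding bound `c − s·D + g + a·q ≤ S`, the constrained Poincaré bound `D ≤ C₁(c + g) + C₂q` and the regime
`μC₁ + sC₁ ≤ 1`, `μC₂ + sC₂ ≤ a` (all slacks non-negative), `μ·D ≤ S`. [folklore] -/
theorem core_lower {S c g q D a C₁ C₂ μ s : ℝ} (hc : 0 ≤ c) (hg : 0 ≤ g) (hq : 0 ≤ q) (hs : 0 ≤ s) (hμ : 0 ≤ μ)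
    (hS : c - s * D + g + a * q ≤ S) (hCP : D ≤ C₁ * (c + g) + C₂ * q)
    (h1 : μ * C₁ + s * C₁ ≤ 1) (h2 : μ * C₂ + s * C₂ ≤ a) : μ * D ≤ S := by
  have hslack : s * D ≤ s * (C₁ * (c + g) + C₂ * q) := mul_le_mul_of_nonneg_left hCP hs
  have hE1 : (μ * C₁ + s * C₁) * (c + g) ≤ 1 * (c + g) := mul_le_mul_of_nonneg_right h1 (add_nonneg hc hg)
  have hQ1 : (μ * C₂ + s * C₂) * q ≤ a * q := mul_le_mul_of_nonneg_right h2 hq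
  have hμD : μ * D ≤ μ * (C₁ * (c + g) + C₂ * q) := mul_le_mul_of_nonneg_left hCP hμ
  nlinarith

/-- The real-number core of §2 (strict form): in the strict regime `sC₁ < 1`, `sC₂ < a`, a vector with `D > 0` has `S > 0`. [folklore] -/
theorem core_pos {S c g q D a C₁ C₂ s : ℝ} (hc : 0 ≤ c) (hg : 0 ≤ g) (hq : 0 ≤ q) (hs : 0 ≤ s) (hD : 0 < D)
    (hS : c - s * D + g + a * q ≤ S) (hCP : D ≤ C₁ * (c + g) + C₂ * q)
    (h1 : s * C₁ < 1) (h2 : s * C₂ < a) : 0 < S := by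
  have hslack : s * D ≤ s * (C₁ * (c + g) + C₂ * q) := mul_le_mul_of_nonneg_left hCP hs
  have hlow : (1 - s * C₁) * (c + g) + (a - s * C₂) * q ≤ S := by nlinarith
  have hm1 : 0 < 1 - s * C₁ := by linarith
  have hm2 : 0 < a - s * C₂ := by linarith
  by_cases hEpos : 0 < c + g
  · nlinarith [mul_pos hm1 hEpos, mul_nonneg hm2.le hq]
  · have hE00 : c + g = 0 := le_antisymm (not_lt.mp hEpos) (add_nonneg hc hg)
    have hQpos : 0 < q := by
      by_contra hQn
      have hQ00 : q = 0 := le_antisymm (not_lt.mp hQn) hq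
      rw [hE00, hQ00] at hCP
      nlinarith
    nlinarith [mul_pos hm2 hQpos, mul_nonneg hm1.le (add_nonneg hc hg)]

/-- **QUANTITATIVE POSITIVITY FROM (CP_W)**: if every skew torus 1-form satisfies the constrained Poincaré inequality
`dirSq Y ≤ C₁·(curlSq W Y∕n + ⟪R D† b, R D† b⟫) + C₂·⟪Q̄ b, Q̄ b⟫`, the background has plaquette radius `η ≥ 0`, and `μ ≥ 0` obeys `μC₁ + 28dη·C₁ ≤ 1`, `μC₂ + 28dη·C₂ ≤ a`,
then `μ·dirSq Y ≤ ⟪b, softSymOpKa a b⟫` for every `b`. [folklore] -/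
theorem inner_softSymOpKa_self_ge_of_constrainedPoincare {η : ℝ} (hη : 0 ≤ η) (hWη : SmallField W η) {a C₁ C₂ μ : ℝ}
    (hμ : 0 ≤ μ) (h1 : μ * C₁ + 28 * d * η * C₁ ≤ 1) (h2 : μ * C₂ + 28 * d * η * C₂ ≤ a)
    (hCP : ∀ b : skewForms d n (N * L ^ (j + 1)),
      dirSq (extF (N * L ^ (j + 1)) (b : Form d n (N * L ^ (j + 1)))) (periodBox (d := d) (N * L ^ (j + 1)))
        ≤ C₁ * (curlSq W (extF (N * L ^ (j + 1)) (b : Form d n (N * L ^ (j + 1)))) (periodBox (d := d) (N * L ^ (j + 1))) / (Fintype.card n : ℝ)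
              + ⟪landauProjK L N (j + 1) W
                  ((LinearMap.adjoint (𝕜 := ℝ) (E := skewSecs d n (N * L ^ (j + 1))) (F := skewForms d n (N * L ^ (j + 1))) (gradOpK hWu (N * L ^ (j + 1)))
                    : skewForms d n (N * L ^ (j + 1)) →ₗ[ℝ] skewSecs d n (N * L ^ (j + 1))) b),
                 landauProjK L N (j + 1) W
                  ((LinearMap.adjoint (𝕜 := ℝ) (E := skewSecs d n (N * L ^ (j + 1))) (F := skewForms d n (N * L ^ (j + 1))) (gradOpK hWu (N * L ^ (j + 1)))
                    : skewForms d n (N * L ^ (j + 1)) →ₗ[ℝ] skewSecs d n (N * L ^ (j + 1))) b)⟫_ℝ)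
          + C₂ * ⟪qbarOpK (N := N) hL j hWu hx hs hWx b, qbarOpK (N := N) hL j hWu hx hs hWx b⟫_ℝ)
    (b : skewForms d n (N * L ^ (j + 1))) :
    μ * dirSq (extF (N * L ^ (j + 1)) (b : Form d n (N * L ^ (j + 1)))) (periodBox (d := d) (N * L ^ (j + 1)))
      ≤ ⟪b, softSymOpKa (N := N) hL j hWu hx hs hWx a b⟫_ℝ :=
  core_lower (div_nonneg (curlSq_nonneg _ _ _) (Nat.cast_nonneg _)) real_inner_self_nonneg real_inner_self_nonneg (by positivity) hμ
    (inner_softSymOpKa_self_ge_energy (N := N) hL j hWu hx hs hWx hη hWη a b) (hCP b) h1 h2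

/-- **(P_a) FROM ONE CONSTRAINED POINCARÉ INEQUALITY** (print's [B8] (1.38)–(1.40) ⟹ [B9] Thm 3.11, on our carrier): under (CP_W), plaquette radius `η ≥ 0` of the background,
and the strict regime `28dη·C₁ < 1`, `28dη·C₂ < a`, the operator `softSymOpKa a` is positive definite on the skew torus 1-forms — literally the hypothesis `hpos` of the END
`NE7ApeCurvedRepRoadBPositivityMassEnd.smallField_of_tanCritical_roadB_positivityMass_end`. [folklore] -/
theorem softSymOpKa_posDef_of_constrainedPoincare {η : ℝ} (hη : 0 ≤ η) (hWη : SmallField W η) {a C₁ C₂ : ℝ}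
    (h1 : 28 * d * η * C₁ < 1) (h2 : 28 * d * η * C₂ < a)
    (hCP : ∀ b : skewForms d n (N * L ^ (j + 1)),
      dirSq (extF (N * L ^ (j + 1)) (b : Form d n (N * L ^ (j + 1)))) (periodBox (d := d) (N * L ^ (j + 1)))
        ≤ C₁ * (curlSq W (extF (N * L ^ (j + 1)) (b : Form d n (N * L ^ (j + 1)))) (periodBox (d := d) (N * L ^ (j + 1))) / (Fintype.card n : ℝ)
              + ⟪landauProjK L N (j + 1) W
                  ((LinearMap.adjoint (𝕜 := ℝ) (E := skewSecs d n (N * L ^ (j + 1))) (F := skewForms d n (N * L ^ (j + 1))) (gradOpK hWu (N * L ^ (j + 1)))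
                    : skewForms d n (N * L ^ (j + 1)) →ₗ[ℝ] skewSecs d n (N * L ^ (j + 1))) b),
                 landauProjK L N (j + 1) W
                  ((LinearMap.adjoint (𝕜 := ℝ) (E := skewSecs d n (N * L ^ (j + 1))) (F := skewForms d n (N * L ^ (j + 1))) (gradOpK hWu (N * L ^ (j + 1)))
                    : skewForms d n (N * L ^ (j + 1)) →ₗ[ℝ] skewSecs d n (N * L ^ (j + 1))) b)⟫_ℝ)
          + C₂ * ⟪qbarOpK (N := N) hL j hWu hx hs hWx b, qbarOpK (N := N) hL j hWu hx hs hWx b⟫_ℝ) :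
    ∀ b : skewForms d n (N * L ^ (j + 1)), b ≠ 0 → 0 < ⟪b, softSymOpKa (N := N) hL j hWu hx hs hWx a b⟫_ℝ :=
  fun b hb0 => core_pos (div_nonneg (curlSq_nonneg _ _ _) (Nat.cast_nonneg _)) real_inner_self_nonneg real_inner_self_nonneg (by positivity)
    (dirSq_extF_pos (d := d) (b := b) hb0) (inner_softSymOpKa_self_ge_energy (N := N) hL j hWu hx hs hWx hη hWη a b) (hCP b) h1 h2

end Carrier

end

end Summit.QuantumFields.BalabanUV.T4Continuum.NE7SoftOperatorEnergyForm
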